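/-
Copyright (c) 2026 the pub-hodgecm-mathlib formalisation cell (harness21).  Prover seat hodgecm-mathlib-K2Liu-p06 (g3): Track B «K2-LIT»,
hLiu418 = stmt-HodgeConjecture-24832, director req649 (S1) ∕ LEAD F0P6-plan (g11) deal of record 2026-09-04T05:23:13Z = organ Φ1 of ROAD Φ
(ruling «M-155l» §2; CENSUS-41 row Φ1): DEFS leaf for `Theorems/K2LiuSiegelUnipotentCharacters.lean` and `Theorems/K2LiuSiegelFourierExpansionDelta.lean`;
2026-09-04.
-/
import Literature.NumberTheory.K2Lit.SiegelDoubledUnipotent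
import Literature.NumberTheory.Automorphic.AdelicAdditiveCharacter
import HarnessLib

/-!
# Crux `HLiu418`, ROAD Φ (Fourier–Euler continuation of the Siegel Eisenstein series), organ Φ1 — DEFS leaf:
# the unipotent characters `ψ_S(u) = ψ_L(tr(S · X(u)))` of `N_Δ(𝔸)`, the Fourier coefficients `φ_S(h)` along `N_Δ(L⁺)\N_Δ(𝔸)`,
# the Whittaker-type big-cell integral `W_S(f)(h)`, and the index group of `T`-skew matrices

Cell `hodgecm-mathlib`, crux item hLiu418 = `stmt-HodgeConjecture-24832`, route of record `HCCMUnconditional`; squad K2 ∕ K2Liu, LEAD F0P6-plan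
(g11 → g12; deal req649 (S1), memo `F0/P6/F0P6-plan-g11/DEALS-req649-S1S2S3.v1.F0P6-plan-g11.md` §(S1)), dealer K2E5-plan (g5) (CENSUS-41 rows Φ1∕Φ2),
prover K2Liu-p06 (g3).  DEFINITIONS WITH BODIES + `rfl`∕algebraic API (no instance, no notation, no named-fact hypothesis, no `sorry`, default
heartbeats); lane `--supports stmt-HodgeConjecture-24832 --as helper` (count-neutral; definitions ⇒ review lane).

THE FRAME (★ D9 `K2Lit/SiegelDoubledUnipotent`, ★ `K2LiuUnipotentChart`).  `H(𝔸) = U(𝕍 ⊕ −𝕍)(𝔸_{L⁺}) ≤ GL_{n+n}(𝔸_L)` (★ `HA`), its Siegel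
parabolic `P_Δ = M_Δ N_Δ`, and the unipotent radical `N_Δ(𝔸) = ↥unipDelta`: in the triangular frame `E₁ · blk u · E₂` the elements of `N_Δ(𝔸)` are
exactly `n(X) = (1 X; 0 1)` with `X = X(u) := (blk u)₁₂ ∈ M_n(𝔸_L)` a `T_𝔸`-SKEW matrix, `T_𝔸 X + σ(X)ᵀ T_𝔸 = 0` (`T = gramR ∈ GL_n(L⁺)` symmetric, `σ = c ⊗ 1`
the conjugation of `𝔸_L`; ★ `skew_of_mem_unipDelta`, ★ `exists_unipChart`); `u ↦ X(u)` is an isomorphism of `N_Δ(𝔸)` onto the additive group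
`Skew_T(𝔸_L) ≅ Herm_n(𝔸_L)` (`X ↦ T_𝔸 X` is skew-hermitian) carrying `N_Δ(L⁺)` onto `Skew_T(L)`.

THE OBJECTS (all `Prop`-free data; junk-free).
* `skewMatrices σ T` — for a commutative ring `R`, a ring endomorphism `σ` and `T ∈ M_ι(R)`: the ADDITIVE SUBGROUP `{X | T X + σ(X)ᵀ T = 0}` of `M_ι(R)`
  (used twice: `R = 𝔸_L` for the coordinates of `N_Δ(𝔸)`, and `R = L`, `σ = c`, `T_L = gramR ⊗ L` for the INDEX GROUP of the Fourier expansion —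
  the Pontryagin dual of `N_Δ(L⁺)\N_Δ(𝔸)` under the trace pairing, see the CHARACTERS file).
* `unipDeltaChar S u := ψ_L(tr(S_𝔸 · X(u))) ∈ 𝕊¹` for `S ∈ M_n(L)`, `u ∈ H(𝔸)` (★ `adeleAddChar L` = Tate's `ψ_L`): on `N_Δ(𝔸)` a continuous unitary
  character, trivial on `N_Δ(L⁺)`; `S ↦ ψ_S|_{N_Δ(𝔸)}` is additive, kills the `T`-HERMITIAN-type `S` (`T_L S = c(S)ᵀ T_L`) and is injective and
  separating on `skewMatrices c T_L` (CHARACTERS file).  Classical shape `ψ(tr(β n(b)))`, [Shimura1997, §18.1 (18.4)], [Tan1999, §3],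
  [KudlaRallis1994, §2], [MoeglinWaldspurger1995, I.2.6 (Fourier expansion along an abelian unipotent radical)].
* `fourierCoeffDelta νN β S φ h := (∫ β dνN)⁻¹ • ∫_{N_Δ(𝔸)} β(u) • (conj ψ_S(u) · φ(u h)) dνN(u)` — the `S`-th FOURIER COEFFICIENT of `φ : H(𝔸) → ℂ`
  along `N_Δ(L⁺)\N_Δ(𝔸)` at `h`, in the COVERING-WEIGHT CURRENCY of ★ O41.4 `K2LiuConstantTermDelta.constTerm_three_cells` (`νN` a left-invariant
  measure on `N_Δ(𝔸)`, `β` an `N_Δ(L⁺)`-covering weight ★ `IsCoveringWeight`; for a left-`N_Δ(L⁺)`-invariant `φ` the value does not depend on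
  `β` — CHARACTERS file — and is `∫_{N_Δ(L⁺)\N_Δ(𝔸)} φ(u h) conj ψ_S(u) du` for the invariant probability `du`).  `S = 0` gives the normalised
  constant term.  [MoeglinWaldspurger1995, I.2.6], [Tan1999, §3], [Shimura1997, §18].
* `whittakerDelta νN S f h := ∫_{N_Δ(𝔸)} conj ψ_S(u) · f(w_Δ u h) dνN(u)` — the `S`-twisted big-cell integral `W_S(f)(h)` (twin of ★ D9
  `intertwiningDelta` = the case `S = 0`), i.e. the contribution of the big Bruhat cell `P_Δ w_Δ N_Δ` to `E_S`; for `det S ≠ 0` it is the whole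
  Fourier coefficient of the Siegel Eisenstein series (organ Φ2, sequel `Theorems/K2LiuSiegelEisensteinCoeffCells.lean`).
  [KudlaRallis1994, §2], [Tan1999, §3], [Shimura1997, §18.3].

API here: membership∕unfolding lemmas (`mem_skewMatrices_iff`, `unipDeltaChar_apply`, `fourierCoeffDelta_def`, `whittakerDelta_def`), the
trivial algebra of the index group (`skewMatrices.map_mem` along a ring hom commuting with `σ`), `unipDeltaChar_zero`, `unipDeltaChar_add`,
`unipDeltaChar_neg`, `whittakerDelta_zero_index` (`W_0 = M(s)`), `fourierCoeffDelta`∕`whittakerDelta` of the zero function.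
NOT here (sequel files of this seat): multiplicativity in `u` on `N_Δ(𝔸)`, continuity, rationality, injectivity∕separation (CHARACTERS file);
the expansion `φ(u h) = Σ_S φ_S(h) ψ_S(u)` (EXPANSION file); the cell unfolding of `E_S` (Φ2).
HONEST LABEL.  Count-neutral DEFS leaf; it pays nothing by itself: `HC_CM` is proved only modulo the 7 printed citations (2 remaining named inputs:
hLiu418 = `stmt-HodgeConjecture-24832`, h413 = `stmt-HodgeConjecture-24833`) until rung 0 closes.

## References (orientation; every statement below is definitional or proved from the tree)
* [MoeglinWaldspurger1995] C. Mœglin, J.-L. Waldspurger, *Spectral decomposition and Eisenstein series*, CUP (1995): I.2.6 (Fourier expansion along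
  a unipotent subgroup), II.1.7.
* [Shimura1997] G. Shimura, *Euler products and Eisenstein series*, CBMS 93 (1997): §18.1–§18.3 (Fourier coefficients of Siegel-type Eisenstein
  series on unitary groups, `E(z,s) = Σ_h c(h,y,s) e(tr(hx))`).
* [Tan1999] V. Tan, *Poles of Siegel Eisenstein series on U(n,n)*, Canad. J. Math. 51 (1999): §3 (the `β`-th Fourier coefficient, big cell).
* [KudlaRallis1994] S. Kudla, S. Rallis, *A regularized Siegel–Weil formula: the first term identity*, Ann. of Math. 140 (1994): §2.
-/

set_option autoImplicit false
-- the mandated namespace repeats the single-problem summit's segment (`HodgeConjecture.HodgeConjecture`)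
set_option linter.dupNamespace false

noncomputable section

open scoped Matrix ENNReal ComplexConjugate
open NumberField IsDedekindDomain MeasureTheory
open Literature.NumberTheory.Automorphic
open Literature.NumberTheory.GelbartRogawski1991 Literature.NumberTheory.GelbartRogawski1991.GRConstruction
open Literature.NumberTheory.K2Lit.SiegelDoubled

namespace Summit.HodgeConjecture.HodgeConjecture.Cruxes.HLiu418.K2LiuSiegelUnipotentFourierDefs

/-! ## §1 The additive group of `T`-skew matrices -/

section Skew

variable {R : Type*} [CommRing R] {ι : Type*} [Fintype ι]

/-- **The additive group `Skew_T(R) = {X ∈ M_ι(R) | T X + σ(X)ᵀ T = 0}` of `T`-skew matrices** (for `T` symmetric `σ`-fixed invertible,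
`X ↦ T X` identifies it with the `σ`-skew-hermitian matrices `Y + σ(Y)ᵀ = 0`); with `R = 𝔸_L`, `σ = c ⊗ 1`, `T = gramR ⊗ 1` this is the coordinate
group of `N_Δ(𝔸)` (★ `skew_of_mem_unipDelta`, ★ `exists_unipChart`), with `R = L`, `σ = c`, `T = gramR ⊗ L` the index group of the Fourier expansion
along `N_Δ(L⁺)\N_Δ(𝔸)`. [cite: MoeglinWaldspurger1995, I.2.6] [cite: Shimura1997, §18.1] -/
def skewMatrices (σ : R →+* R) (T : Matrix ι ι R) : AddSubgroup (Matrix ι ι R) where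
  carrier := {X | T * X + (X.map σ)ᵀ * T = 0}
  zero_mem' := by
    simp only [Set.mem_setOf_eq, Matrix.mul_zero, Matrix.map_zero σ (map_zero σ), Matrix.transpose_zero, Matrix.zero_mul, add_zero]
  add_mem' := by
    intro X Y hX hY
    simp only [Set.mem_setOf_eq] at hX hY ⊢
    rw [Matrix.mul_add, Matrix.map_add σ (map_add σ), Matrix.transpose_add, Matrix.add_mul, add_add_add_comm, hX, hY, add_zero]
  neg_mem' := by
    intro X hX
    simp only [Set.mem_setOf_eq] at hX ⊢
    rw [Matrix.mul_neg, Matrix.map_neg σ (map_neg σ), Matrix.transpose_neg, Matrix.neg_mul, ← neg_add, hX, neg_zero]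

/-- membership in `Skew_T(R)` (definitional). [cite: Shimura1997, §18.1] -/
theorem mem_skewMatrices_iff (σ : R →+* R) (T X : Matrix ι ι R) :
    X ∈ skewMatrices σ T ↔ T * X + (X.map σ)ᵀ * T = 0 :=
  Iff.rfl

/-- **`Skew` is functorial**: a ring hom `f : R → R'` intertwining `σ` and `σ'` carries `Skew_T(R)` into `Skew_{f(T)}(R')` (rational skew matrices are
adelic skew matrices: `R = L → 𝔸_L`). [cite: Shimura1997, §18.1] -/
theorem map_mem_skewMatrices {R' : Type*} [CommRing R'] {σ : R →+* R} {σ' : R' →+* R'} (f : R →+* R') (hf : ∀ x, f (σ x) = σ' (f x))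
    {T X : Matrix ι ι R} (hX : X ∈ skewMatrices σ T) : X.map f ∈ skewMatrices σ' (T.map f) := by
  rw [mem_skewMatrices_iff] at hX ⊢
  have hXσ : (X.map f).map σ' = (X.map σ).map f := by
    rw [Matrix.map_map, Matrix.map_map]
    exact congrArg X.map (funext fun x => (hf x).symm)
  rw [hXσ, ← Matrix.transpose_map, ← Matrix.map_mul, ← Matrix.map_mul, ← Matrix.map_add f (map_add f), hX,
    Matrix.map_zero f (map_zero f)]

end Skew

/-! ## §2 The unipotent characters `ψ_S`, the Fourier coefficients `φ_S(h)`, the big-cell integral `W_S(f)(h)` -/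

variable (L : Type) [Field L] [NumberField L] [IsCMField L]
variable {N M n : ℕ} (e : Fin N × Fin M ≃ Fin n)
  (dV : Fin N → L) (hdV : ∀ i, IsCMField.complexConj L (dV i) = dV i)
  (dW : Fin M → L) (hdW : ∀ i, IsCMField.complexConj L (dW i) = dW i)

/-- **The unipotent character `ψ_S(u) := ψ_L(tr(S_𝔸 · X(u)))`**, `S ∈ M_n(L)`, `u ∈ H(𝔸)`, `X(u) = (blk u)₁₂` the frame coordinate of ★ D9 ∕
★ `K2LiuUnipotentChart`, `ψ_L =` ★ `adeleAddChar L` (Tate's standard character).  On `N_Δ(𝔸)` it is a continuous unitary character trivial on `N_Δ(L⁺)`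
(CHARACTERS file); it is defined on all of `H(𝔸)` for convenience (no group law is claimed off `N_Δ(𝔸)`).  Classical `ψ(tr(β n(b)))`.
[cite: Shimura1997, §18.1 (18.4)] [cite: Tan1999, §3] [cite: MoeglinWaldspurger1995, I.2.6] -/
def unipDeltaChar (S : Matrix (Fin n) (Fin n) L) (u : HA L e dV hdV dW hdW) : Circle :=
  adeleAddChar L (Matrix.trace (S.map (algebraMap L (AdeleRing (𝓞 L) L)) * (blk L e dV hdV dW hdW u).toBlocks₁₂))

/-- unfolding of `unipDeltaChar`. [cite: Shimura1997, §18.1 (18.4)] -/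
theorem unipDeltaChar_apply (S : Matrix (Fin n) (Fin n) L) (u : HA L e dV hdV dW hdW) :
    unipDeltaChar L e dV hdV dW hdW S u =
      adeleAddChar L (Matrix.trace (S.map (algebraMap L (AdeleRing (𝓞 L) L)) * (blk L e dV hdV dW hdW u).toBlocks₁₂)) :=
  rfl

/-- `ψ_0 = 1`. [cite: Shimura1997, §18.1] -/
theorem unipDeltaChar_zero (u : HA L e dV hdV dW hdW) : unipDeltaChar L e dV hdV dW hdW 0 u = 1 := by
  rw [unipDeltaChar_apply, Matrix.map_zero _ (map_zero _), Matrix.zero_mul, Matrix.trace_zero, AddChar.map_zero_eq_one]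

/-- **additivity in the index**: `ψ_{S + S'} = ψ_S · ψ_{S'}`. [cite: Shimura1997, §18.1] -/
theorem unipDeltaChar_add (S S' : Matrix (Fin n) (Fin n) L) (u : HA L e dV hdV dW hdW) :
    unipDeltaChar L e dV hdV dW hdW (S + S') u = unipDeltaChar L e dV hdV dW hdW S u * unipDeltaChar L e dV hdV dW hdW S' u := by
  rw [unipDeltaChar_apply, unipDeltaChar_apply, unipDeltaChar_apply, Matrix.map_add _ (map_add _), Matrix.add_mul, Matrix.trace_add,
    AddChar.map_add_eq_mul]

/-- `ψ_{−S} = ψ_S⁻¹`. [cite: Shimura1997, §18.1] -/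
theorem unipDeltaChar_neg (S : Matrix (Fin n) (Fin n) L) (u : HA L e dV hdV dW hdW) :
    unipDeltaChar L e dV hdV dW hdW (-S) u = (unipDeltaChar L e dV hdV dW hdW S u)⁻¹ := by
  rw [unipDeltaChar_apply, unipDeltaChar_apply, Matrix.map_neg _ (map_neg _), Matrix.neg_mul, Matrix.trace_neg, AddChar.map_neg_eq_inv]

/-- `ψ_{−S} = conj ψ_S` as complex numbers. [cite: Shimura1997, §18.1] -/
theorem coe_unipDeltaChar_neg (S : Matrix (Fin n) (Fin n) L) (u : HA L e dV hdV dW hdW) :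
    (unipDeltaChar L e dV hdV dW hdW (-S) u : ℂ) = conj (unipDeltaChar L e dV hdV dW hdW S u : ℂ) := by
  rw [unipDeltaChar_neg, Circle.coe_inv_eq_conj]

/-- `|ψ_S(u)| = 1`. [cite: Shimura1997, §18.1] -/
theorem norm_coe_unipDeltaChar (S : Matrix (Fin n) (Fin n) L) (u : HA L e dV hdV dW hdW) :
    ‖(unipDeltaChar L e dV hdV dW hdW S u : ℂ)‖ = 1 :=
  Circle.norm_coe _

/-- **The `S`-th Fourier coefficient of `φ` along `N_Δ(L⁺)\N_Δ(𝔸)` at `h`** (covering-weight currency of ★ O41.4):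
`φ_S(h) := (∫ β dνN)⁻¹ • ∫_{N_Δ(𝔸)} β(u) • (conj ψ_S(u) · φ(u h)) dνN(u)`, for a measure `νN` on `N_Δ(𝔸)` and a weight `β : N_Δ(𝔸) → [0, ∞]`
(intended: `νN` left-invariant, `β` an `N_Δ(L⁺)`-covering weight with `0 < ∫ β < ∞`; then for left-`N_Δ(L⁺)`-invariant `φ` the value is independent
of `β` and equals the coefficient for the invariant probability measure of the compact group `N_Δ(L⁺)\N_Δ(𝔸)`).  Junk: Bochner `0` for a
non-integrable integrand, `(∞).toReal⁻¹ = (0).toReal⁻¹ = 0`. [cite: MoeglinWaldspurger1995, I.2.6] [cite: Tan1999, §3] [cite: Shimura1997, §18.1] -/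
def fourierCoeffDelta [MeasurableSpace (unipDelta L e dV hdV dW hdW)] (νN : Measure (unipDelta L e dV hdV dW hdW))
    (β : unipDelta L e dV hdV dW hdW → ℝ≥0∞) (S : Matrix (Fin n) (Fin n) L) (φ : HA L e dV hdV dW hdW → ℂ) (h : HA L e dV hdV dW hdW) : ℂ :=
  ((∫⁻ u, β u ∂νN).toReal⁻¹ : ℝ) •
    ∫ u, (β u).toReal • (conj (unipDeltaChar L e dV hdV dW hdW S (u : HA L e dV hdV dW hdW) : ℂ) * φ ((u : HA L e dV hdV dW hdW) * h)) ∂νN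

/-- unfolding of `fourierCoeffDelta`. [cite: MoeglinWaldspurger1995, I.2.6] -/
theorem fourierCoeffDelta_def [MeasurableSpace (unipDelta L e dV hdV dW hdW)] (νN : Measure (unipDelta L e dV hdV dW hdW))
    (β : unipDelta L e dV hdV dW hdW → ℝ≥0∞) (S : Matrix (Fin n) (Fin n) L) (φ : HA L e dV hdV dW hdW → ℂ) (h : HA L e dV hdV dW hdW) :
    fourierCoeffDelta L e dV hdV dW hdW νN β S φ h =
      ((∫⁻ u, β u ∂νN).toReal⁻¹ : ℝ) •
        ∫ u, (β u).toReal • (conj (unipDeltaChar L e dV hdV dW hdW S (u : HA L e dV hdV dW hdW) : ℂ) * φ ((u : HA L e dV hdV dW hdW) * h)) ∂νN :=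
  rfl

/-- the Fourier coefficients of the zero function vanish. [cite: MoeglinWaldspurger1995, I.2.6] -/
theorem fourierCoeffDelta_zero_fun [MeasurableSpace (unipDelta L e dV hdV dW hdW)] (νN : Measure (unipDelta L e dV hdV dW hdW))
    (β : unipDelta L e dV hdV dW hdW → ℝ≥0∞) (S : Matrix (Fin n) (Fin n) L) (h : HA L e dV hdV dW hdW) :
    fourierCoeffDelta L e dV hdV dW hdW νN β S (fun _ => 0) h = 0 := by
  simp [fourierCoeffDelta]

/-- **the `0`-th coefficient is the normalised constant term in covering-weight currency**:
`φ_0(h) = (∫ β dνN)⁻¹ • ∫ β(u) • φ(u h) dνN(u)`. [cite: MoeglinWaldspurger1995, I.2.6, II.1.7] -/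
theorem fourierCoeffDelta_zero_index [MeasurableSpace (unipDelta L e dV hdV dW hdW)] (νN : Measure (unipDelta L e dV hdV dW hdW))
    (β : unipDelta L e dV hdV dW hdW → ℝ≥0∞) (φ : HA L e dV hdV dW hdW → ℂ) (h : HA L e dV hdV dW hdW) :
    fourierCoeffDelta L e dV hdV dW hdW νN β 0 φ h =
      ((∫⁻ u, β u ∂νN).toReal⁻¹ : ℝ) • ∫ u, (β u).toReal • φ ((u : HA L e dV hdV dW hdW) * h) ∂νN := by
  rw [fourierCoeffDelta_def]
  simp only [unipDeltaChar_zero, Circle.coe_one, map_one, one_mul]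

/-- **The `S`-twisted big-cell integral `W_S(f)(h) := ∫_{N_Δ(𝔸)} conj ψ_S(u) · f(w_Δ u h) dνN(u)`** (twin of ★ D9 `intertwiningDelta`, the case
`S = 0`): the contribution of the big Bruhat cell `P_Δ w_Δ N_Δ` to the `S`-th Fourier coefficient of the Siegel Eisenstein series `E(·; f)`;
absolutely convergent for `Re s > n/2` on Siegel sections (★ #9 ∕ O41.3), Eulerian on pure tensors.  Junk: Bochner `0` when not integrable.
[cite: KudlaRallis1994, §2] [cite: Tan1999, §3] [cite: Shimura1997, §18.3] -/
def whittakerDelta [MeasurableSpace (unipDelta L e dV hdV dW hdW)] (νN : Measure (unipDelta L e dV hdV dW hdW))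
    (S : Matrix (Fin n) (Fin n) L) (f : HA L e dV hdV dW hdW → ℂ) (h : HA L e dV hdV dW hdW) : ℂ :=
  ∫ u, conj (unipDeltaChar L e dV hdV dW hdW S (u : HA L e dV hdV dW hdW) : ℂ) *
    f (weylDelta L e dV hdV dW hdW * (u : HA L e dV hdV dW hdW) * h) ∂νN

/-- unfolding of `whittakerDelta`. [cite: KudlaRallis1994, §2] -/
theorem whittakerDelta_def [MeasurableSpace (unipDelta L e dV hdV dW hdW)] (νN : Measure (unipDelta L e dV hdV dW hdW))
    (S : Matrix (Fin n) (Fin n) L) (f : HA L e dV hdV dW hdW → ℂ) (h : HA L e dV hdV dW hdW) :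
    whittakerDelta L e dV hdV dW hdW νN S f h =
      ∫ u, conj (unipDeltaChar L e dV hdV dW hdW S (u : HA L e dV hdV dW hdW) : ℂ) *
        f (weylDelta L e dV hdV dW hdW * (u : HA L e dV hdV dW hdW) * h) ∂νN :=
  rfl

/-- **`W_0 = M(s)`**: at the zero index the twisted big-cell integral is ★ D9's Siegel intertwining integral `intertwiningDelta`.
[cite: KudlaRallis1994, §2] [cite: MoeglinWaldspurger1995, II.1.6] -/
theorem whittakerDelta_zero_index [MeasurableSpace (unipDelta L e dV hdV dW hdW)] (νN : Measure (unipDelta L e dV hdV dW hdW))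
    (f : HA L e dV hdV dW hdW → ℂ) (h : HA L e dV hdV dW hdW) :
    whittakerDelta L e dV hdV dW hdW νN 0 f h = intertwiningDelta L e dV hdV dW hdW νN f h := by
  rw [whittakerDelta_def]
  unfold intertwiningDelta
  simp only [unipDeltaChar_zero, Circle.coe_one, map_one, one_mul]

/-- the twisted big-cell integral of the zero section vanishes. [cite: KudlaRallis1994, §2] -/
theorem whittakerDelta_zero_fun [MeasurableSpace (unipDelta L e dV hdV dW hdW)] (νN : Measure (unipDelta L e dV hdV dW hdW))
    (S : Matrix (Fin n) (Fin n) L) (h : HA L e dV hdV dW hdW) :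
    whittakerDelta L e dV hdV dW hdW νN S (fun _ => 0) h = 0 := by
  simp [whittakerDelta]

/-- `|conj ψ_S(u) · z| = |z|`: twisting by `ψ_S` does not change absolute convergence (so `W_S(f)` converges exactly where `M(s)f` does).
[cite: Tan1999, §3] -/
theorem norm_conj_unipDeltaChar_mul (S : Matrix (Fin n) (Fin n) L) (u : HA L e dV hdV dW hdW) (z : ℂ) :
    ‖conj (unipDeltaChar L e dV hdV dW hdW S u : ℂ) * z‖ = ‖z‖ := by
  rw [norm_mul, Complex.norm_conj, norm_coe_unipDeltaChar, one_mul]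

end Summit.HodgeConjecture.HodgeConjecture.Cruxes.HLiu418.K2LiuSiegelUnipotentFourierDefs

end
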